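import Literature.RepresentationTheory.KonnoKonno2007.JunctionCartanDecomposition
import Literature.NumberTheory.Automorphic.HaarConjCompact
import Mathlib.MeasureTheory.Measure.Haar.Unique
import Mathlib.Analysis.Matrix.Spectrum
import HarnessLib

/-!
# The real unitary groups `U(H) ≤ GL_n(ℂ)` of non-degenerate hermitian matrices are unimodular (Knapp (2002), VIII.§2 Cor. 8.31)

Topic `NumberTheory/Automorphic`; namespaces `Literature.NumberTheory.Automorphic` (§1, §3) and
`Literature.RepresentationTheory.KonnoKonno2007` (§2, the statements about ★ `unitaryFormGroup`). THEOREMS ONLY (no definition,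
no named fact, no instance, no notation).

* §1 **transport of the modular character** along isomorphisms of topological groups:
  `modularCharacterFun_continuousMulEquiv : Δ_H (e g) = Δ_G g` for `e : G ≃ₜ* H` (Mathlib's `haarScalarFactor_map` and
  `modularCharacter_continuousMulEquiv` of ★ `GLnGelfandKazhdanInvolution` are the case `H = G`), hence
  `modularCharacterFun_eq_one_of_continuousMulEquiv` (`Δ_H ≡ 1 ⇒ Δ_G ≡ 1`).
* §2 **`U(J)` is unimodular for a hermitian involution `J`** (`Jᴴ = J`, `J² = 1`; all the `U(p, q)`):
  `modularCharacter_eq_one_unitaryFormGroup` — the elementary Cartan argument of ★ `modularCharacter_eq_one_glInf` (there for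
  `GL_n(K_∞)`): `g = k · exp X` with `k` in the COMPACT `U(J) ∩ U(n)` and `X ∈ 𝔲(J)` hermitian (★
  `unitaryFormGroup_hasCartanDecomposition`); `Δ(k) = 1` (★ `modularCharacter_eq_one_of_mem_isCompact`); and `Δ(exp X) = 1` because
  `exp X` is conjugate IN `U(J)` to its inverse: `X J = −J X`, so `J · exp X · J⁻¹ = exp(−X)` with `J ∈ U(J)`, and a positive real
  character agreeing at `exp X` and `(exp X)⁻¹` is `1` there.
* §3 **`U(⋆, H)` is unimodular for every non-degenerate hermitian `H ∈ M_n(ℂ)`**: the existence half of Sylvester's law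
  (`exists_conjTranspose_mul_mul_eq_diagonal_signs`: `Tᴴ H T = diag(±1)`, from Mathlib's spectral theorem
  `Matrix.IsHermitian.conjStarAlgAut_star_eigenvectorUnitary` by rescaling the unitary eigenframe) makes `U(⋆, H)` conjugate to a
  `U(J)` of §2 (★ `unitaryGroupOfFormCongrOfEq`), and §1 transports `Δ ≡ 1` (`modularCharacterFun_unitaryGroupOfForm_eq_one`);
  with the plumbing `locallyCompactSpace_unitaryGroupOfForm_complex` / `secondCountableTopology_unitaryGroupOfForm_complex`.

This is the unimodularity input of the archimedean orbital measures of the cell `hodgecm-mathlib` (★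
`Rogawski1990/ArchOrbitalMeasureRegular`, hypothesis `hΔ`; the CM dress `U(H)(L ⊗ ℝ) ≃ₜ* Π_w U(σ_w H)(ℂ)` is the sequel
`UnitaryGroupArchUnimodular`), reductive real groups being unimodular [Knapp2002, Cor. 8.31].

## References
* A. W. Knapp, *Lie Groups Beyond an Introduction*, 2nd ed. (2002), VIII.§2 Cor. 8.31; VI Thm. 6.31 [Knapp2002].
* R. A. Horn, C. R. Johnson, *Matrix Analysis*, 2nd ed. (2013), §4.5 Thm. 4.5.7 (every hermitian matrix is `*`-congruent to its
  inertia matrix) [HornJohnson2013].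
* G. B. Folland, *A Course in Abstract Harmonic Analysis* (1995), §2.4 Prop. 2.27 (modular function) [Folland1995].
* N. Bourbaki, *Intégration*, Ch. VII §1 no. 3 (modular function on compact subgroups).
-/

set_option autoImplicit false

noncomputable section

open MeasureTheory Measure NormedSpace
open scoped Matrix MatrixGroups NNReal

/-! ## §1 Transport of the modular character along `G ≃ₜ* H` -/

namespace Literature.NumberTheory.Automorphic

section Transport

variable {G H : Type*} [Group G] [TopologicalSpace G] [IsTopologicalGroup G] [LocallyCompactSpace G]
  [Group H] [TopologicalSpace H] [IsTopologicalGroup H] [LocallyCompactSpace H]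

omit [LocallyCompactSpace G] in
/-- Mathlib's `haarScalarFactor_map` across two groups: pushing two Haar measures forward along `φ : G ≃ₜ* H` does not change
their ratio. [cite: Folland1995, §2.4 Prop. 2.27] -/
theorem haarScalarFactor_map_continuousMulEquiv [MeasurableSpace G] [BorelSpace G] [MeasurableSpace H] [BorelSpace H]
    (μ' μ : Measure G) [IsHaarMeasure μ] [IsHaarMeasure μ'] (φ : G ≃ₜ* H) :
    (μ'.map φ).haarScalarFactor (μ.map φ) = μ'.haarScalarFactor μ := by
  obtain ⟨⟨f, f_cont⟩, hf⟩ := exists_continuous_nonneg_pos (1 : H)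
  have int_f_ne_zero : ∫ x, f x ∂(μ.map φ) ≠ 0 :=
    ne_of_gt (f_cont.integral_pos_of_hasCompactSupport_nonneg_nonzero hf.1 hf.2.1 hf.2.2)
  rw [← NNReal.coe_inj, haarScalarFactor_eq_integral_div_of_continuous_nonneg_pos _ _ hf,
    haarScalarFactor_eq_integral_div μ' μ (f_cont.comp φ.continuous),
    integral_map (by fun_prop) (by fun_prop), integral_map (by fun_prop) (by fun_prop)]
  · rfl
  · exact hf.1.comp_homeomorph φ.toHomeomorph
  · change ∫ x, f (φ x) ∂μ ≠ 0
    rwa [← integral_map (by fun_prop) f_cont.aestronglyMeasurable]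

/-- **The modular character is transported by isomorphisms of topological groups**: `Δ_H(e g) = Δ_G(g)` for `e : G ≃ₜ* H`
(push the defining Haar measure of `G` forward along `e`). [cite: Folland1995, §2.4 Prop. 2.27] -/
theorem modularCharacterFun_continuousMulEquiv (e : G ≃ₜ* H) (g : G) :
    modularCharacterFun (e g) = modularCharacterFun g := by
  borelize G H
  set μ : Measure G := MeasureTheory.Measure.haar
  have hme : Measurable (e : G → H) := e.continuous.measurable
  rw [modularCharacterFun_eq_haarScalarFactor (μ.map e) (e g), modularCharacterFun_eq_haarScalarFactor μ g]
  have hcomm : (μ.map e).map (· * e g) = (μ.map (· * g)).map e := by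
    rw [Measure.map_map (measurable_mul_const _) hme, Measure.map_map hme (measurable_mul_const _)]
    congr 1
    funext x
    simp only [Function.comp_apply, map_mul]
  convert haarScalarFactor_map_continuousMulEquiv (μ.map (· * g)) μ e using 2

/-- `Δ ≡ 1` is transported by isomorphisms of topological groups: if `G ≃ₜ* H` and `H` is unimodular, so is `G`.
[cite: Folland1995, §2.4 Prop. 2.27] -/
theorem modularCharacterFun_eq_one_of_continuousMulEquiv (e : G ≃ₜ* H) (hH : ∀ h : H, modularCharacterFun h = 1) (g : G) :
    modularCharacterFun g = 1 := by
  rw [← modularCharacterFun_continuousMulEquiv e g]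
  exact hH (e g)

/-- If `g` is conjugate to its inverse (`j g j⁻¹ = g⁻¹`) then `Δ(g) = 1`: `Δ` is a character into the commutative `ℝ≥0`, so
`Δ(g) = Δ(g⁻¹) = Δ(g)⁻¹`. [cite: Knapp2002, VIII.§2 Cor. 8.31] -/
theorem modularCharacter_eq_one_of_conj_eq_inv {g j : G} (h : j * g * j⁻¹ = g⁻¹) : modularCharacter g = 1 := by
  have hj0 : modularCharacter j ≠ 0 := (modularCharacterFun_pos _).ne'
  have hg0 : modularCharacter g ≠ 0 := (modularCharacterFun_pos _).ne'
  have h1 : modularCharacter g = (modularCharacter g)⁻¹ := by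
    have h2 := congrArg modularCharacter h
    rwa [map_mul, map_mul, map_inv, map_inv, mul_right_comm, mul_inv_cancel₀ hj0, one_mul] at h2
  have h3 : modularCharacter g ^ 2 = 1 := by
    rw [sq]
    nth_rewrite 2 [h1]
    exact mul_inv_cancel₀ hg0
  exact (pow_eq_one_iff_of_nonneg _root_.bot_le two_ne_zero).1 h3

end Transport

end Literature.NumberTheory.Automorphic

/-! ## §2 `U(J)` is unimodular for a hermitian involution `J` -/

namespace Literature.RepresentationTheory.KonnoKonno2007

open Literature.NumberTheory.Automorphic

variable {n : Type*} [Fintype n] [DecidableEq n]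

/-- For a hermitian `X` with `Xᴴ J + J X = 0` (`X ∈ 𝔲(J) ∩ 𝔭`) and `J² = 1`: `J · exp X · J = (exp X)⁻¹` (`X J = −J X`, so
`J X J⁻¹ = −X` and `exp` commutes with conjugation). [cite: Knapp2002, VI Thm. 6.31] -/
theorem conj_exp_eq_inv_of_conjTranspose_mul_add (J : Matrix n n ℂ) (hJJ : J * J = 1) {X : Matrix n n ℂ}
    (hX : Xᴴ * J + J * X = 0) (hXs : IsSelfAdjoint X) :
    J * exp X * J = (exp X)⁻¹ := by
  have hJu : IsUnit J := ⟨⟨J, J, hJJ, hJJ⟩, rfl⟩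
  have hJinv : J⁻¹ = J := Matrix.inv_eq_left_inv hJJ
  have hXh : Xᴴ = X := hXs.star_eq
  -- `J X J = -X`
  have hJXJ : J * X * J⁻¹ = -X := by
    rw [hXh] at hX
    have h1 : J * X = -(X * J) := eq_neg_of_add_eq_zero_right hX
    rw [hJinv, h1, neg_mul, Matrix.mul_assoc, hJJ, Matrix.mul_one]
  calc J * exp X * J = J * exp X * J⁻¹ := by rw [hJinv]
    _ = exp (J * X * J⁻¹) := (Matrix.exp_conj J X hJu).symm
    _ = (exp X)⁻¹ := by rw [hJXJ, Matrix.exp_neg]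

/-- **`U(J)` is unimodular**: the modular character of `↥(unitaryFormGroup J hJ hJJ).carrier = U(⋆, J) ≤ GL_n(ℂ)` is trivial,
for every hermitian involution `J ∈ M_n(ℂ)` — all the real groups `U(p, q)` [Knapp2002, Cor. 8.31: reductive Lie groups are
unimodular]. Cartan decomposition `g = k · exp X` (★ `unitaryFormGroup_hasCartanDecomposition`), `Δ = 1` on the compact
`U(J) ∩ U(n)` (★ `modularCharacter_eq_one_of_mem_isCompact`), and `Δ(exp X) = 1` since `exp X` is conjugate in `U(J)` (by `J`) to its
inverse. Local compactness of the group is an instance hypothesis (as in ★ `modularCharacter_eq_one_glInf`; discharged by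
`locallyCompactSpace_unitaryGroupOfForm_complex`). [cite: Knapp2002, VIII.§2 Cor. 8.31] -/
theorem modularCharacter_eq_one_unitaryFormGroup (J : Matrix n n ℂ) (hJ : Jᴴ = J) (hJJ : J * J = 1)
    [LocallyCompactSpace (unitaryFormGroup J hJ hJJ).carrier] (g : (unitaryFormGroup J hJ hJJ).carrier) :
    modularCharacter g = 1 := by
  borelize ↥(unitaryFormGroup J hJ hJJ).carrier
  -- Cartan decomposition of `g`
  obtain ⟨k, hk, X, hXlie, hXs, hg⟩ := unitaryFormGroup_hasCartanDecomposition J hJ hJJ g g.2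
  have hkG : k ∈ (unitaryFormGroup J hJ hJJ).carrier := (unitaryFormGroup J hJ hJJ).maximalCompact_le_carrier hk
  have heG : expGL X ∈ (unitaryFormGroup J hJ hJJ).carrier := by
    simpa only [one_smul] using (unitaryFormGroup J hJ hJJ).expGL_smul_mem X hXlie 1
  -- `J ∈ U(J)`
  have hJu : IsUnit J := ⟨⟨J, J, hJJ, hJJ⟩, rfl⟩
  have hJG : hJu.unit ∈ (unitaryFormGroup J hJ hJJ).carrier := by
    rw [mem_unitaryFormGroup_carrier_iff, IsUnit.unit_spec, hJ, hJJ, Matrix.one_mul]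
  -- the three elements of the group `U(J)`
  set kG : (unitaryFormGroup J hJ hJJ).carrier := ⟨k, hkG⟩ with hkG_def
  set eG : (unitaryFormGroup J hJ hJJ).carrier := ⟨expGL X, heG⟩ with heG_def
  set jG : (unitaryFormGroup J hJ hJJ).carrier := ⟨hJu.unit, hJG⟩ with hjG_def
  have hgke : g = kG * eG := Subtype.ext hg
  -- `Δ(k) = 1`: `k` lies in the compact subgroup `U(J) ∩ U(n)`
  have hK : IsCompact (((unitaryFormGroup J hJ hJJ).maximalCompact.subgroupOf (unitaryFormGroup J hJ hJJ).carrier :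
      Subgroup (unitaryFormGroup J hJ hJJ).carrier) : Set (unitaryFormGroup J hJ hJJ).carrier) :=
    (unitaryFormGroup J hJ hJJ).isClosed.isClosedEmbedding_subtypeVal.isCompact_preimage
      ((unitaryFormGroup J hJ hJJ).isCompact_maximalCompact_holds isStarFormallyReal_complex)
  have hk1 : modularCharacter kG = 1 :=
    modularCharacter_eq_one_of_mem_isCompact hK (Subgroup.mem_subgroupOf.2 hk)
  -- `Δ(exp X) = 1`: `exp X` is conjugate to its inverse by `J ∈ U(J)`
  have hconj : jG * eG * jG⁻¹ = eG⁻¹ := by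
    refine Subtype.ext (Units.ext ?_)
    change (hJu.unit : Matrix n n ℂ) * (expGL X : Matrix n n ℂ) * ((hJu.unit⁻¹ : (Matrix n n ℂ)ˣ) : Matrix n n ℂ) =
      (((expGL X)⁻¹ : GL n ℂ) : Matrix n n ℂ)
    have hJJu : hJu.unit * hJu.unit = 1 := Units.ext (by rw [Units.val_mul, IsUnit.unit_spec, hJJ, Units.val_one])
    have hJunitinv : ((hJu.unit⁻¹ : (Matrix n n ℂ)ˣ) : Matrix n n ℂ) = J := by
      rw [inv_eq_of_mul_eq_one_right hJJu, IsUnit.unit_spec]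
    rw [hJunitinv, IsUnit.unit_spec, coe_expGL, ← expGL_neg, coe_expGL, Matrix.exp_neg]
    exact conj_exp_eq_inv_of_conjTranspose_mul_add J hJJ hXlie hXs
  have he1 : modularCharacter eG = 1 := modularCharacter_eq_one_of_conj_eq_inv hconj
  rw [hgke, map_mul, hk1, he1, one_mul]

/-- `Δ ≡ 1` on `U(J)` in the `modularCharacterFun` spelling (the hypothesis shape of ★ `exists_orbitalMeasureFamily_of_forall_comm` and ★
`exists_isAdmissibleOn_isRegularElt_arch_of_unimodular`). [cite: Knapp2002, VIII.§2 Cor. 8.31] -/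
theorem modularCharacterFun_eq_one_unitaryFormGroup (J : Matrix n n ℂ) (hJ : Jᴴ = J) (hJJ : J * J = 1)
    [LocallyCompactSpace (unitaryFormGroup J hJ hJJ).carrier] (g : (unitaryFormGroup J hJ hJJ).carrier) :
    modularCharacterFun g = 1 :=
  modularCharacter_eq_one_unitaryFormGroup J hJ hJJ g

end Literature.RepresentationTheory.KonnoKonno2007

/-! ## §3 Every non-degenerate hermitian `H`: Sylvester normal form and `U(⋆, H)` unimodular -/

namespace Literature.NumberTheory.Automorphic

open Literature.RepresentationTheory.KonnoKonno2007

variable {n : Type*} [Fintype n] [DecidableEq n]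

/-- `GL_n(ℂ)` is locally compact (units of the locally compact Hausdorff ring `M_n(ℂ)`). [cite: PlatonovRapinchuk1994, §3.2] -/
theorem locallyCompactSpace_GL_complex : LocallyCompactSpace (GL n ℂ) := by
  haveI : LocallyCompactSpace (Matrix n n ℂ) := inferInstanceAs (LocallyCompactSpace (n → n → ℂ))
  infer_instance

/-- `GL_n(ℂ)` is second countable (embedded in `M_n(ℂ) × M_n(ℂ)ᵐᵒᵖ`). [cite: PlatonovRapinchuk1994, §3.2] -/
theorem secondCountableTopology_GL_complex : SecondCountableTopology (GL n ℂ) := by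
  haveI : SecondCountableTopology (Matrix n n ℂ) := inferInstanceAs (SecondCountableTopology (n → n → ℂ))
  haveI : SecondCountableTopology (Matrix n n ℂ)ᵐᵒᵖ := MulOpposite.opHomeomorph.symm.secondCountableTopology
  exact Units.isEmbedding_embedProduct.secondCountableTopology

/-- `U(⋆, H)(ℂ) = {g | gᴴ H g = H}` is closed in `GL_n(ℂ)`. [cite: PlatonovRapinchuk1994, §3.2] -/
theorem isClosed_unitaryGroupOfForm_complex (H : Matrix n n ℂ) :
    IsClosed ((unitaryGroupOfForm (starRingEnd ℂ) H : Subgroup (GL n ℂ)) : Set (GL n ℂ)) := by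
  have h1 : Continuous fun g : GL n ℂ => (g : Matrix n n ℂ) := Units.continuous_val
  exact isClosed_eq (((h1.matrix_map Complex.continuous_conj).matrix_transpose.mul continuous_const).mul h1)
    continuous_const

/-- `U(⋆, H)(ℂ)` is locally compact (closed in `GL_n(ℂ)`). [cite: PlatonovRapinchuk1994, §3.2] -/
theorem locallyCompactSpace_unitaryGroupOfForm_complex (H : Matrix n n ℂ) :
    LocallyCompactSpace (unitaryGroupOfForm (starRingEnd ℂ) H) := by
  haveI := locallyCompactSpace_GL_complex (n := n)
  exact (isClosed_unitaryGroupOfForm_complex H).locallyCompactSpace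

/-- `U(⋆, H)(ℂ)` is second countable. [cite: PlatonovRapinchuk1994, §3.2] -/
theorem secondCountableTopology_unitaryGroupOfForm_complex (H : Matrix n n ℂ) :
    SecondCountableTopology (unitaryGroupOfForm (starRingEnd ℂ) H) := by
  haveI := secondCountableTopology_GL_complex (n := n)
  exact Topology.IsEmbedding.subtypeVal.secondCountableTopology

/-- **Sylvester normal form of a non-degenerate hermitian matrix** (existence half of the law of inertia): if `H ∈ M_n(ℂ)` is
hermitian with `det H ≠ 0` there are `T ∈ GL_n(ℂ)` and signs `ε_i = ±1` with `Tᴴ H T = diag(ε)` — rescale the unitary eigenframe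
`Uᴴ H U = diag(λ)` (Mathlib `Matrix.IsHermitian.conjStarAlgAut_star_eigenvectorUnitary`) by `|λ_i|^{-1/2}` (all `λ_i ≠ 0` as
`det H = ∏ λ_i`). [cite: HornJohnson2013, §4.5 Thm 4.5.7] -/
theorem exists_conjTranspose_mul_mul_eq_diagonal_signs {H : Matrix n n ℂ} (hH : H.IsHermitian) (hdet : H.det ≠ 0) :
    ∃ (T : GL n ℂ) (ε : n → ℝ), (∀ i, ε i = 1 ∨ ε i = -1) ∧
      (T : Matrix n n ℂ)ᴴ * H * (T : Matrix n n ℂ) = Matrix.diagonal (fun i => ((ε i : ℝ) : ℂ)) := by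
  obtain ⟨U, hUdef⟩ : ∃ U : Matrix n n ℂ, U = (hH.eigenvectorUnitary : Matrix n n ℂ) := ⟨_, rfl⟩
  obtain ⟨d, hd⟩ : ∃ d : n → ℝ, d = hH.eigenvalues := ⟨_, rfl⟩
  have hU0 : Uᴴ * H * U = Matrix.diagonal (RCLike.ofReal ∘ d) := by
    have h := hH.conjStarAlgAut_star_eigenvectorUnitary
    rw [Unitary.conjStarAlgAut_star_apply] at h
    rw [hUdef, hd]
    simpa only [Unitary.coe_star, Matrix.star_eq_conjTranspose] using h
  have hU : Uᴴ * H * U = Matrix.diagonal (fun i => ((d i : ℝ) : ℂ)) := by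
    rw [hU0]
    rfl
  -- all eigenvalues are nonzero
  have hd0 : ∀ i, d i ≠ 0 := by
    intro i hi
    apply hdet
    rw [hH.det_eq_prod_eigenvalues]
    exact Finset.prod_eq_zero (Finset.mem_univ i) (by rw [← hd, hi]; simp)
  -- the rescaling and the signs
  obtain ⟨s, hs⟩ : ∃ s : n → ℝ, s = fun i => (Real.sqrt |d i|)⁻¹ := ⟨_, rfl⟩
  obtain ⟨ε, hε⟩ : ∃ ε : n → ℝ, ε = fun i => if 0 < d i then 1 else -1 := ⟨_, rfl⟩
  have key : ∀ i, s i * d i * s i = ε i := by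
    intro i
    have hsq : s i * s i = |d i|⁻¹ := by
      rw [hs]
      dsimp only
      rw [← mul_inv, Real.mul_self_sqrt (abs_nonneg _)]
    calc s i * d i * s i = d i * (s i * s i) := by ring
      _ = d i * |d i|⁻¹ := by rw [hsq]
      _ = ε i := by
        rw [hε]
        dsimp only
        rcases lt_or_gt_of_ne (hd0 i) with hneg | hpos
        · rw [abs_of_neg hneg, if_neg (not_lt.2 hneg.le), inv_neg, mul_neg, mul_inv_cancel₀ (hd0 i)]
        · rw [abs_of_pos hpos, if_pos hpos, mul_inv_cancel₀ (hd0 i)]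
  set Tm : Matrix n n ℂ := U * Matrix.diagonal (fun i => ((s i : ℝ) : ℂ)) with hTm
  have hdiag : (Matrix.diagonal (fun i => ((s i : ℝ) : ℂ)))ᴴ = Matrix.diagonal (fun i => ((s i : ℝ) : ℂ)) := by
    rw [Matrix.diagonal_conjTranspose]
    congr 1
    funext i
    exact Complex.conj_ofReal _
  have hTm' : Tmᴴ * H * Tm = Matrix.diagonal (fun i => ((ε i : ℝ) : ℂ)) := by
    rw [hTm, Matrix.conjTranspose_mul, hdiag]
    calc Matrix.diagonal (fun i => ((s i : ℝ) : ℂ)) * Uᴴ * H * (U * Matrix.diagonal (fun i => ((s i : ℝ) : ℂ)))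
        = Matrix.diagonal (fun i => ((s i : ℝ) : ℂ)) * (Uᴴ * H * U) * Matrix.diagonal (fun i => ((s i : ℝ) : ℂ)) := by
          simp only [Matrix.mul_assoc]
      _ = Matrix.diagonal (fun i => ((s i : ℝ) : ℂ) * ((d i : ℝ) : ℂ) * ((s i : ℝ) : ℂ)) := by
          rw [hU, Matrix.diagonal_mul_diagonal, Matrix.diagonal_mul_diagonal]
      _ = Matrix.diagonal (fun i => ((ε i : ℝ) : ℂ)) := by
          congr 1
          funext i
          exact_mod_cast key i
  have hε1 : ∀ i, ε i = 1 ∨ ε i = -1 := by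
    intro i
    rw [hε]
    dsimp only
    by_cases h : 0 < d i
    · exact Or.inl (if_pos h)
    · exact Or.inr (if_neg h)
  have hdetT : Tm.det ≠ 0 := by
    intro h0
    have h := congrArg Matrix.det hTm'
    rw [Matrix.det_mul, Matrix.det_mul, h0, mul_zero, Matrix.det_diagonal] at h
    refine absurd h.symm (Finset.prod_ne_zero_iff.2 fun i _ => ?_)
    rcases hε1 i with h1 | h1 <;> rw [h1] <;> norm_num
  exact ⟨Matrix.GeneralLinearGroup.mkOfDetNeZero Tm hdetT, ε, hε1, hTm'⟩

/-- A non-degenerate hermitian `H ∈ M_n(ℂ)` is `*`-congruent to a HERMITIAN INVOLUTION: `Tᴴ H T = J` with `Jᴴ = J`, `J² = 1`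
(`J = diag(±1)`), in the tree's frame currency `formCongr ⋆ T H = J`. [cite: HornJohnson2013, §4.5 Thm 4.5.7] -/
theorem exists_formCongr_star_eq_hermitian_involution {H : Matrix n n ℂ} (hH : H.IsHermitian) (hdet : H.det ≠ 0) :
    ∃ (T : GL n ℂ) (J : Matrix n n ℂ), Jᴴ = J ∧ J * J = 1 ∧ formCongr (starRingEnd ℂ) T H = J := by
  obtain ⟨T, ε, hε, hT⟩ := exists_conjTranspose_mul_mul_eq_diagonal_signs hH hdet
  refine ⟨T, _, ?_, ?_, by rw [formCongr_star, hT]⟩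
  · rw [Matrix.diagonal_conjTranspose]
    congr 1
    funext i
    exact Complex.conj_ofReal _
  · rw [Matrix.diagonal_mul_diagonal, ← Matrix.diagonal_one]
    congr 1
    funext i
    rcases hε i with h | h <;> rw [h] <;> norm_num

/-- **`U(⋆, H)(ℂ)` is unimodular for every non-degenerate hermitian `H ∈ M_n(ℂ)`** (all the real unitary groups `U(p, q)`,
`p + q = n`): `Δ ≡ 1` on `↥(unitaryGroupOfForm (starRingEnd ℂ) H)`. By the Sylvester frame `Tᴴ H T = J` (`J` a hermitian involution)
`U(⋆, H)` is isomorphic, as a topological group, to `U(⋆, J) = U(J)` (★ `unitaryGroupOfFormCongrOfEq`, `g ↦ T g T⁻¹`), which is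
unimodular (§2); the modular character is transported along the isomorphism (§1). [cite: Knapp2002, VIII.§2 Cor. 8.31] -/
theorem modularCharacterFun_unitaryGroupOfForm_eq_one {H : Matrix n n ℂ} (hH : H.IsHermitian) (hdet : H.det ≠ 0)
    [LocallyCompactSpace (unitaryGroupOfForm (starRingEnd ℂ) H)] (g : unitaryGroupOfForm (starRingEnd ℂ) H) :
    modularCharacterFun g = 1 := by
  obtain ⟨T, J, hJ, hJJ, hT⟩ := exists_formCongr_star_eq_hermitian_involution hH hdet
  haveI hLJ : LocallyCompactSpace (unitaryGroupOfForm (starRingEnd ℂ) J) := locallyCompactSpace_unitaryGroupOfForm_complex J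
  haveI : LocallyCompactSpace (unitaryFormGroup J hJ hJJ).carrier := hLJ
  have hUJ : ∀ k : unitaryGroupOfForm (starRingEnd ℂ) J, modularCharacterFun k = 1 := fun k =>
    modularCharacterFun_eq_one_unitaryFormGroup J hJ hJJ k
  exact modularCharacterFun_eq_one_of_continuousMulEquiv (unitaryGroupOfFormCongrOfEq (starRingEnd ℂ) T H J hT).symm hUJ g

/-- The same in the `modularCharacter` (homomorphism) spelling. [cite: Knapp2002, VIII.§2 Cor. 8.31] -/
theorem modularCharacter_unitaryGroupOfForm_eq_one {H : Matrix n n ℂ} (hH : H.IsHermitian) (hdet : H.det ≠ 0)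
    [LocallyCompactSpace (unitaryGroupOfForm (starRingEnd ℂ) H)] (g : unitaryGroupOfForm (starRingEnd ℂ) H) :
    modularCharacter g = 1 :=
  modularCharacterFun_unitaryGroupOfForm_eq_one hH hdet g

end Literature.NumberTheory.Automorphic

end
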